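import Summits.HubbardSuperconductivity.HubbardSuperconductivity.Theorems.CooperPairDMottWalkPlaquetteModel

/-!
# Route `CooperPairDMottWalk`, support `PlaquettePairBinding`: sector coordinates of the plaquette

Helper file for the certified exact diagonalisation of the `2 × 2` Hubbard plaquette (item
stmt-HubbardSuperconductivity-1181), in the computable `Fin 4` model `ham4 U = hamiltonian plaqGraph4 1 U`
of `CooperPairDMottWalkPlaquetteModel` (unitarily equivalent to `plaquetteHamiltonian U =
hubbardTorus 2 2 1 U`; the 4-cycle `0 ∼ 1 ∼ 3 ∼ 2 ∼ 0`). In Lieb's two-species coordinates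
(`Literature…TwoSpecies.coeffMatrix`) a vector of the sector `(N↑, N↓) = (a, b)` of the four-site
cluster is a `C(4,a) × C(4,b)` array, and `H` acts by the spinless hopping matrices `K₁` (one
fermion on `C₄`, `4 × 4`) and `K₂` (two fermions, `6 × 6`, with the Jordan–Wigner signs of the
order `0 < 1 < 2 < 3` of `Fin 4`) plus `U ×` double occupancy
(`TwoSpecies.re_sector_hamiltonian_eq`). This file fixes the literal enumerations `s1`, `s2` of the
one- and two-element subsets, tabulates `K₁`, `K₂` and the double-occupancy tables (checked against
the definitions by `decide`), and records the resulting formulas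
`Re ⟨ψ, H(U) ψ⟩ = hopForm + U · dblForm` in the three sectors `(1,1)` (two electrons, `S^z = 0`),
`(2,2)` (half filling, `S^z = 0`) and `(2,1)` (three electrons, `S^z = ½`).

Sources: E. H. Lieb, PRL 62 (1989) 1201, eq. (4); the tables are a finite computation.
-/

set_option linter.dupNamespace false

namespace Summit.HubbardSuperconductivity.HubbardSuperconductivity.Theorems.CooperPairDMottWalk

open Literature.MathematicalPhysics.QuantumLattice Literature.MathematicalPhysics.QuantumLattice.TwoSpecies
open Matrix Finset

/-! ### Subset enumerations -/

/-- Enumeration of the one-element subsets of `Fin 4`. [folklore] -/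
def s1 (i : Fin 4) : Finset (Fin 4) := {i}

/-- Enumeration of the two-element subsets of `Fin 4` (lexicographic). [folklore] -/
def s2 : Fin 6 → Finset (Fin 4) := ![{0, 1}, {0, 2}, {0, 3}, {1, 2}, {1, 3}, {2, 3}]

/-- `s1` enumerates the `1`-subsets. [folklore] -/
theorem isSubsetEnum_s1 : IsSubsetEnum 1 s1 where
  inj i j h := (by decide : ∀ i j : Fin 4, s1 i = s1 j → i = j) i j h
  image_eq := by decide +kernel

/-- `s2` enumerates the `2`-subsets. [folklore] -/
theorem isSubsetEnum_s2 : IsSubsetEnum 2 s2 where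
  inj i j h := (by decide : ∀ i j : Fin 6, s2 i = s2 j → i = j) i j h
  image_eq := by decide +kernel

/-! ### Hopping and double-occupancy tables -/

/-- `K₁`: the hopping matrix of one fermion on the 4-cycle (`-1` on the bonds
`0∼1`, `0∼2`, `1∼3`, `2∼3`). [folklore] -/
def K1 : Fin 4 → Fin 4 → ℤ := ![![0, -1, -1, 0], ![-1, 0, 0, -1], ![-1, 0, 0, -1], ![0, -1, -1, 0]]

/-- `K₂`: the hopping matrix of two fermions on the 4-cycle in the enumeration `s2`, with the
Jordan–Wigner sign `-1` for a hop over an occupied intermediate site. [folklore] -/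
def K2 : Fin 6 → Fin 6 → ℤ :=
  ![![0, 0, -1, 1, 0, 0], ![0, 0, -1, -1, 0, 0], ![-1, -1, 0, 0, -1, -1], ![1, -1, 0, 0, -1, 1],
    ![0, 0, -1, -1, 0, 0], ![0, 0, -1, 1, 0, 0]]

/-- Double occupancy `|s1 i ∩ s1 j|`. [folklore] -/
def d11 : Fin 4 → Fin 4 → ℕ := fun i j => if i = j then 1 else 0

/-- Double occupancy `|s2 i ∩ s2 j|`. [folklore] -/
def d22 : Fin 6 → Fin 6 → ℕ :=
  ![![2, 1, 1, 1, 1, 0], ![1, 2, 1, 1, 0, 1], ![1, 1, 2, 0, 1, 1], ![1, 1, 0, 2, 1, 1], ![1, 0, 1, 1, 2, 1],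
    ![0, 1, 1, 1, 1, 2]]

/-- Double occupancy `|s2 i ∩ s1 j|`. [folklore] -/
def d21 : Fin 6 → Fin 4 → ℕ :=
  ![![1, 1, 0, 0], ![1, 0, 1, 0], ![1, 0, 0, 1], ![0, 1, 1, 0], ![0, 1, 0, 1], ![0, 0, 1, 1]]

/-- The table `K₁` is the hopping matrix between one-element subsets. [folklore] -/
theorem hopInt_s1 : ∀ i j : Fin 4, hopInt plaqGraph4 (s1 i) (s1 j) = -K1 i j := by
  decide +kernel

/-- The table `K₂` is the hopping matrix between two-element subsets. [folklore] -/
theorem hopInt_s2 : ∀ i j : Fin 6, hopInt plaqGraph4 (s2 i) (s2 j) = -K2 i j := by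
  decide +kernel

/-- The table `d11`. [folklore] -/
theorem card_s1_inter_s1 : ∀ i j : Fin 4, (s1 i ∩ s1 j).card = d11 i j := by decide +kernel

/-- The table `d22`. [folklore] -/
theorem card_s2_inter_s2 : ∀ i j : Fin 6, (s2 i ∩ s2 j).card = d22 i j := by decide +kernel

/-- The table `d21`. [folklore] -/
theorem card_s2_inter_s1 : ∀ (i : Fin 6) (j : Fin 4), (s2 i ∩ s1 j).card = d21 i j := by
  decide +kernel

/-- Hopping entries of the plaquette between one-element subsets. [folklore] -/
theorem hoppingMatrix_s1 (i j : Fin 4) :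
    hoppingMatrix plaqGraph4 1 (s1 i) (s1 j) = (K1 i j : ℂ) := by
  rw [hoppingMatrix_eq_cast, hopInt_s1]; push_cast; ring

/-- Hopping entries of the plaquette between two-element subsets. [folklore] -/
theorem hoppingMatrix_s2 (i j : Fin 6) :
    hoppingMatrix plaqGraph4 1 (s2 i) (s2 j) = (K2 i j : ℂ) := by
  rw [hoppingMatrix_eq_cast, hopInt_s2]; push_cast; ring

/-! ### The three sectors -/

/-- Coordinates of a vector of the `Fin 4` model in the sector `(1,1)` (two electrons, `S^z = 0`). [folklore] -/
noncomputable def w11 (ψ : Fock (Orb (Fin 4))) : Fin 4 → Fin 4 → ℂ :=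
  fun i j => coeffMatrix ψ (s1 i) (s1 j)

/-- Coordinates in the sector `(2,2)` (half filling, `S^z = 0`). [folklore] -/
noncomputable def w22 (ψ : Fock (Orb (Fin 4))) : Fin 6 → Fin 6 → ℂ :=
  fun i j => coeffMatrix ψ (s2 i) (s2 j)

/-- Coordinates in the sector `(2,1)` (three electrons, `S^z = ½`). [folklore] -/
noncomputable def w21 (ψ : Fock (Orb (Fin 4))) : Fin 6 → Fin 4 → ℂ :=
  fun i j => coeffMatrix ψ (s2 i) (s1 j)

/-- Sector `(1,1)`: `Re ⟨ψ, ψ⟩ = normSqW (w11 ψ)` and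
`Re ⟨ψ, H(U) ψ⟩ = hopForm K1 K1 (w11 ψ) + U · dblForm d11 (w11 ψ)`. [folklore] -/
theorem sector11_forms (U : ℝ) {ψ : Fock (Orb (Fin 4))} (hψ : IsInSector 1 1 ψ) :
    (star ψ ⬝ᵥ ψ).re = normSqW (w11 ψ) ∧
      (star ψ ⬝ᵥ (ham4 U *ᵥ ψ)).re = hopForm K1 K1 (w11 ψ) + U * dblForm d11 (w11 ψ) :=
  ⟨re_sector_norm_eq isSubsetEnum_s1 isSubsetEnum_s1 hψ,
    re_sector_hamiltonian_eq plaqGraph4 isSubsetEnum_s1 isSubsetEnum_s1 1 U hoppingMatrix_s1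
      hoppingMatrix_s1 card_s1_inter_s1 hψ⟩

/-- Sector `(2,2)`: `Re ⟨ψ, ψ⟩ = normSqW (w22 ψ)` and
`Re ⟨ψ, H(U) ψ⟩ = hopForm K2 K2 (w22 ψ) + U · dblForm d22 (w22 ψ)`. [folklore] -/
theorem sector22_forms (U : ℝ) {ψ : Fock (Orb (Fin 4))} (hψ : IsInSector 2 2 ψ) :
    (star ψ ⬝ᵥ ψ).re = normSqW (w22 ψ) ∧
      (star ψ ⬝ᵥ (ham4 U *ᵥ ψ)).re = hopForm K2 K2 (w22 ψ) + U * dblForm d22 (w22 ψ) :=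
  ⟨re_sector_norm_eq isSubsetEnum_s2 isSubsetEnum_s2 hψ,
    re_sector_hamiltonian_eq plaqGraph4 isSubsetEnum_s2 isSubsetEnum_s2 1 U hoppingMatrix_s2
      hoppingMatrix_s2 card_s2_inter_s2 hψ⟩

/-- Sector `(2,1)`: `Re ⟨ψ, ψ⟩ = normSqW (w21 ψ)` and
`Re ⟨ψ, H(U) ψ⟩ = hopForm K2 K1 (w21 ψ) + U · dblForm d21 (w21 ψ)`. [folklore] -/
theorem sector21_forms (U : ℝ) {ψ : Fock (Orb (Fin 4))} (hψ : IsInSector 2 1 ψ) :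
    (star ψ ⬝ᵥ ψ).re = normSqW (w21 ψ) ∧
      (star ψ ⬝ᵥ (ham4 U *ᵥ ψ)).re = hopForm K2 K1 (w21 ψ) + U * dblForm d21 (w21 ψ) :=
  ⟨re_sector_norm_eq isSubsetEnum_s2 isSubsetEnum_s1 hψ,
    re_sector_hamiltonian_eq plaqGraph4 isSubsetEnum_s2 isSubsetEnum_s1 1 U hoppingMatrix_s2
      hoppingMatrix_s1 card_s2_inter_s1 hψ⟩

end Summit.HubbardSuperconductivity.HubbardSuperconductivity.Theorems.CooperPairDMottWalk
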